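import Summits.Ventures.CertifiedManyBodySolver.Observables.StiffnessTLOddMomentLocalObsTT
import Summits.Ventures.CertifiedManyBodySolver.Observables.StiffnessTLOddMomentIdentification
import Summits.Ventures.CertifiedManyBodySolver.Rows.DopedTLCorr
import HarnessLib

/-!
# Ventures/CertifiedManyBodySolver — Observables: the odd-moment (Krylov-3) stiffness row for the
# `t–t'` torus — finite-volume ceiling, identification of the moments as torus averages of LOCAL
# commutator observables, torus limit, and the UNCONDITIONAL row adapter (any real `t'`)

HONEST FRAMING: one-sided CEILINGS on the flux stiffness (helicity modulus / superfluid weight); not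
a superconductivity verdict; no stiffness floor follows from equal-time data and an energy window.

Cell `hubbard-obs` (D-0042), seat p2 (stiffness). `t'`-general twin of `StiffnessTLOddMomentCeiling.lean` +
`StiffnessTLOddMomentIdentification.lean` (which treat `t' = 0`), so that the A0 anchor of the cell
(`(U, n, t') = (8, 7/8, −1/4)`) has the same Lean chain as A0′: for `H = hubbardTorusTT' L 1 t' U`,
`𝒦 = kinOpTT' L t'`, `𝒥 = curOpTT' L t'`, `B = H𝒥 − 𝒥H` and a uniform flux stiffness `ρ_s` of the `t–t'` flux
envelope `E_L(θ) = fluxEnergyTT' L t' U δ θ`: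

* `fluxStiffness_mul_sq_le_kinetic_add_oddMomentsTT` — finite volume (`L ≥ 3`), every unit sector ground state:
  `ρ_s L² ≤ ½Re⟨ψ,𝒦ψ⟩ + 2λ m₁(ψ) + λ² m₃(ψ)` (the trial direction `Bψ` in the second-order Rayleigh inequality
  `stiffnessTT'_mul_sq_le_of_isGroundStateInSector` of the Literature file, any `t'`);
* `firstMoment_eq_torusAvgExpectTT`, `thirdMoment_eq_torusAvgExpectTT`, `oddMomentFunctionalTT'_eq_torusAvgExpect`
  — for an eigenvector / sector ground state the moments are `½L²`, `−½L²` times the translation averages of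
  the LOCAL observables `firstMomentObsTT`, `thirdMomentObsTT` (`L ≥ 9 / 15`);
* `fluxStiffness_le_of_torusLimitTT'_functional_row` — the generic "finite ceiling + torus limit ⇒ row" adapter
  for the `t–t'` class (`exists_unit_isGroundStateInSector_hubbardTorusTT'`, weak-⋆ compactness);
* `tendsto_oddMomentFunctionalTT'_of_isTorusLimitOf` (identification) and
  **`fluxStiffness_le_of_torusLimitTT'_oddMoment_certificate`**: a certificate
  `oddMomentLimitFunctionalTT t' U λ ω ≤ q` on the `t–t'` torus-limit ground-state class gives `ρ_s ≤ q`
  (`−1 ≤ δ ≤ 1`; tree units).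

References: [Kohn1964]; [ScalapinoWhiteZhang1993] §II; [Lipparini2008] eqs. (8.30), (8.39);
[BohigasLaneMartorell1979]; [XuEtAl2024] eq. (1); [BratteliRobinsonII1997] §5.2.2, §6.2.1;
[BratteliRobinsonI1987] §4.3.1.
-/

noncomputable section

namespace Summit.Ventures.CertifiedManyBodySolver.Observables

open Matrix Finset Filter Topology
open Literature.MathematicalPhysics.QuantumLattice
open Literature.MathematicalPhysics.QuantumLattice.ThermodynamicLimit
open Literature.MathematicalPhysics.QuantumFieldTheory
open Literature.Probability.LatticeModels
open scoped ComplexOrder ComplexConjugate Topology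

section Finite

variable (L : ℕ) [NeZero L]

/-! ### Finite volume: the fixed-`λ` odd-moment ceiling for the `t–t'` torus -/

/-- **Fixed-`λ` odd-moment (Krylov) stiffness ceiling, `t–t'` torus** (`L ≥ 3`): if
`ρ_s θ² ≤ E_L(θ) − E_L(0)` for `|θ| ≤ θ₀` (`θ₀ > 0`, `E_L = fluxEnergyTT' L t' U δ`), then every
`(N_L, 0)`-sector ground state `ψ` (unit vector) of `hubbardTorusTT' L 1 t' U` satisfies, for every real `λ`,
`ρ_s L² ≤ ½Re⟨ψ,𝒦ψ⟩ + 2λ m₁(ψ) + λ² m₃(ψ)`, `m₁ = Re⟨𝒥ψ, H𝒥ψ⟩ − E₀‖𝒥ψ‖²`, `B = H𝒥 − 𝒥H`,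
`m₃ = Re⟨Bψ, HBψ⟩ − E₀‖Bψ‖²` (direction `η = Bψ`; `Re⟨ψ, 𝒥(Bψ)⟩ = m₁`). [cite: Lipparini2008, eq. (8.30)] -/
theorem fluxStiffness_mul_sq_le_kinetic_add_oddMomentsTT (hL : 3 ≤ L) (tp : ℝ) {U δ ρs θ₀ : ℝ} (hθ₀ : 0 < θ₀)
    (hst : ∀ θ : ℝ, |θ| ≤ θ₀ → ρs * θ ^ 2 ≤ fluxEnergyTT' L tp U δ θ - fluxEnergyTT' L tp U δ 0)
    {ψ : Fock (Orb (FermionTorus 2 L))}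
    (hgs : IsGroundStateInSector (hubbardTorusTT' L 1 tp U) (2 * ⌊(1 - δ) * (L : ℝ) ^ 2 / 2⌋₊) 0 ψ)
    (h1 : star ψ ⬝ᵥ ψ = 1) (lam : ℝ) :
    ρs * (L : ℝ) ^ 2 ≤
      (star ψ ⬝ᵥ (kinOpTT' L tp *ᵥ ψ)).re / 2 +
        2 * lam * ((star (curOpTT' L tp *ᵥ ψ) ⬝ᵥ (hubbardTorusTT' L 1 tp U *ᵥ (curOpTT' L tp *ᵥ ψ))).re -
          fluxEnergyTT' L tp U δ 0 * (star (curOpTT' L tp *ᵥ ψ) ⬝ᵥ (curOpTT' L tp *ᵥ ψ)).re) +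
        lam ^ 2 * ((star ((hubbardTorusTT' L 1 tp U * curOpTT' L tp - curOpTT' L tp * hubbardTorusTT' L 1 tp U) *ᵥ ψ) ⬝ᵥ
            (hubbardTorusTT' L 1 tp U *ᵥ
              ((hubbardTorusTT' L 1 tp U * curOpTT' L tp - curOpTT' L tp * hubbardTorusTT' L 1 tp U) *ᵥ ψ))).re -
          fluxEnergyTT' L tp U δ 0 *
            (star ((hubbardTorusTT' L 1 tp U * curOpTT' L tp - curOpTT' L tp * hubbardTorusTT' L 1 tp U) *ᵥ ψ) ⬝ᵥ
              ((hubbardTorusTT' L 1 tp U * curOpTT' L tp - curOpTT' L tp * hubbardTorusTT' L 1 tp U) *ᵥ ψ)).re) := by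
  have hHmem : ∀ v ∈ szSector (2 * ⌊(1 - δ) * (L : ℝ) ^ 2 / 2⌋₊) (0 : ℝ),
      hubbardTorusTT' L 1 tp U *ᵥ v ∈ szSector (2 * ⌊(1 - δ) * (L : ℝ) ^ 2 / 2⌋₊) (0 : ℝ) :=
    fun v hv => mulVec_mem_szSector_of_commute (hubbardTorusTT'_commute_totalNumber L 1 tp U)
      (hubbardTorusTT'_commute_spinZ L 1 tp U) hv
  have hη : (hubbardTorusTT' L 1 tp U * curOpTT' L tp - curOpTT' L tp * hubbardTorusTT' L 1 tp U) *ᵥ ψ ∈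
      szSector (2 * ⌊(1 - δ) * (L : ℝ) ^ 2 / 2⌋₊) 0 := by
    rw [sub_mulVec, ← mulVec_mulVec, ← mulVec_mulVec]
    exact Submodule.sub_mem _ (hHmem _ (curOpTT'_mulVec_mem_szSector tp hgs.1))
      (curOpTT'_mulVec_mem_szSector tp (hHmem _ hgs.1))
  have h := stiffnessTT'_mul_sq_le_of_isGroundStateInSector hL tp U δ hθ₀ hst hgs h1 hη lam
  have hE : hubbardTorusTT' L 1 tp U *ᵥ ψ = ((fluxEnergyTT' L tp U δ 0 : ℝ) : ℂ) • ψ := by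
    rw [fluxEnergyTT'_eq, hubbardTorusTT'Flux_zero]
    exact hgs.2.2
  set H := hubbardTorusTT' L 1 tp U with hHdef
  set J := curOpTT' L tp with hJdef
  have hJv : ∀ v : Fock (Orb (FermionTorus 2 L)), star ψ ⬝ᵥ (J *ᵥ v) = star (J *ᵥ ψ) ⬝ᵥ v := fun v => by
    rw [star_mulVec, (isHermitian_curOpTT' (L := L) tp).eq, ← dotProduct_mulVec]
  have hovC : star ψ ⬝ᵥ (J *ᵥ ((H * J - J * H) *ᵥ ψ)) =
      star (J *ᵥ ψ) ⬝ᵥ (H *ᵥ (J *ᵥ ψ)) -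
        ((fluxEnergyTT' L tp U δ 0 : ℝ) : ℂ) * (star (J *ᵥ ψ) ⬝ᵥ (J *ᵥ ψ)) := by
    rw [sub_mulVec, ← mulVec_mulVec, ← mulVec_mulVec, hE, mulVec_smul, mulVec_sub, mulVec_smul,
      dotProduct_sub, dotProduct_smul, hJv (H *ᵥ (J *ᵥ ψ)), hJv (J *ᵥ ψ), smul_eq_mul]
  have hov : (star ψ ⬝ᵥ (J *ᵥ ((H * J - J * H) *ᵥ ψ))).re =
      (star (J *ᵥ ψ) ⬝ᵥ (H *ᵥ (J *ᵥ ψ))).re -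
        fluxEnergyTT' L tp U δ 0 * (star (J *ᵥ ψ) ⬝ᵥ (J *ᵥ ψ)).re := by
    rw [hovC]
    simp only [Complex.sub_re, Complex.mul_re, Complex.ofReal_re, Complex.ofReal_im, zero_mul, sub_zero]
  rw [hov] at h
  exact h

/-! ### The moments `m₁`, `m₃` of an eigenvector as torus averages of local observables -/

/-- **`m₁` is local** (`t–t'` torus, `L ≥ 9`): for a vector `ψ` with `Hψ = Eψ`,
`Re⟨𝒥ψ, H𝒥ψ⟩ − E‖𝒥ψ‖² = ½ L² · Re(torus average of d₁ in ψ)`, `d₁ = firstMomentObsTT t' U`.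
[cite: Lipparini2008, eq. (8.30)] -/
theorem firstMoment_eq_torusAvgExpectTT (tp U : ℝ) (hL : 9 ≤ L) {E : ℝ} {ψ : Fock (Orb (FermionTorus 2 L))}
    (hE : hubbardTorusTT' L 1 tp U *ᵥ ψ = ((E : ℝ) : ℂ) • ψ) :
    (star (curOpTT' L tp *ᵥ ψ) ⬝ᵥ (hubbardTorusTT' L 1 tp U *ᵥ (curOpTT' L tp *ᵥ ψ))).re -
        E * (star (curOpTT' L tp *ᵥ ψ) ⬝ᵥ (curOpTT' L tp *ᵥ ψ)).re =
      (L : ℝ) ^ 2 / 2 * (torusAvgExpectAt L (box 2 4) (firstMomentObsTT tp U) ψ).re := by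
  have hΩ : Set.InjOn (Torus.proj (d := 2) L) ↑(box 2 4) := injOn_proj_box (by omega)
  have hZ3 : Set.InjOn (Torus.proj (d := 2) L) ↑(box 2 3) := injOn_proj_box (by omega)
  have h14 : box 2 1 ⊆ box 2 4 := box_subset_box (by norm_num)
  have h24 : box 2 2 ⊆ box 2 4 := box_subset_box (by norm_num)
  have hJ : (curOpTT' L tp)ᴴ = curOpTT' L tp := (isHermitian_curOpTT' (L := L) tp).eq
  -- (1) `m₁ = Re⟨ψ, 𝒥 B ψ⟩`
  have hJv : ∀ v : Fock (Orb (FermionTorus 2 L)),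
      star (curOpTT' L tp *ᵥ ψ) ⬝ᵥ v = star ψ ⬝ᵥ (curOpTT' L tp *ᵥ v) := fun v => by
    rw [star_mulVec, hJ, ← dotProduct_mulVec]
  have hstep1 : (star (curOpTT' L tp *ᵥ ψ) ⬝ᵥ (hubbardTorusTT' L 1 tp U *ᵥ (curOpTT' L tp *ᵥ ψ))).re -
        E * (star (curOpTT' L tp *ᵥ ψ) ⬝ᵥ (curOpTT' L tp *ᵥ ψ)).re =
      (star ψ ⬝ᵥ ((curOpTT' L tp *
        (hubbardTorusTT' L 1 tp U * curOpTT' L tp - curOpTT' L tp * hubbardTorusTT' L 1 tp U)) *ᵥ ψ)).re := by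
    rw [← mulVec_mulVec, sub_mulVec, ← mulVec_mulVec, ← mulVec_mulVec, hE, mulVec_smul, ← hJv,
      dotProduct_sub, dotProduct_smul, smul_eq_mul, Complex.sub_re, Complex.re_ofReal_mul]
  -- (2) `Re⟨ψ, 𝒥Bψ⟩ = ½Re⟨ψ, [𝒥,B]ψ⟩`
  have hXY : (curOpTT' L tp * (hubbardTorusTT' L 1 tp U * curOpTT' L tp - curOpTT' L tp * hubbardTorusTT' L 1 tp U))ᴴ =
      -((hubbardTorusTT' L 1 tp U * curOpTT' L tp - curOpTT' L tp * hubbardTorusTT' L 1 tp U) * curOpTT' L tp) := by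
    rw [conjTranspose_mul, conjTranspose_commutator_curOpTT'_TT, hJ, neg_mul]
  rw [hstep1, re_star_dotProduct_mul_mulVec_eq_half _ _ hXY]
  -- (3) `[𝒥, B]` is the translation sum of `Γ(d₁)`
  have hcomm : star ψ ⬝ᵥ ((curOpTT' L tp *
        (hubbardTorusTT' L 1 tp U * curOpTT' L tp - curOpTT' L tp * hubbardTorusTT' L 1 tp U) -
      (hubbardTorusTT' L 1 tp U * curOpTT' L tp - curOpTT' L tp * hubbardTorusTT' L 1 tp U) * curOpTT' L tp) *ᵥ ψ) =
      ((L : ℂ) ^ 2) * torusAvgExpectAt L (box 2 4) (firstMomentObsTT tp U) ψ := by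
    have h := expect_commutator_sum_relabel_translate L hΩ hZ3 h14 h24
      (fun z hz => by simpa using shiftSet_subset_box_add (subset_refl (box 2 1)) hz)
      (fun a ha c hc => by simpa using sub_mem_box_add ha hc) (curBondObsTT_mem_carEvenSubalgebra tp)
      (curDerivObsTT tp U) ψ
    rw [← curOpTT'_eq_sum_translate L tp, ← hubbardTorusTT'_commutator_curOpTT' L tp U (by omega)] at h
    exact h
  rw [hcomm, show ((L : ℂ) ^ 2 * torusAvgExpectAt L (box 2 4) (firstMomentObsTT tp U) ψ).re =
      (L : ℝ) ^ 2 * (torusAvgExpectAt L (box 2 4) (firstMomentObsTT tp U) ψ).re by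
    rw [← Complex.ofReal_natCast, ← Complex.ofReal_pow, Complex.re_ofReal_mul]]
  ring

/-- **`m₃` is local** (`t–t'` torus, `L ≥ 15`): for a vector `ψ` with `Hψ = Eψ` and `B = H𝒥 − 𝒥H`,
`Re⟨Bψ, HBψ⟩ − E‖Bψ‖² = −½ L² · Re(torus average of m₃' in ψ)`, `m₃' = thirdMomentObsTT t' U`.
[cite: Lipparini2008, eq. (8.30)] -/
theorem thirdMoment_eq_torusAvgExpectTT (tp U : ℝ) (hL : 15 ≤ L) {E : ℝ} {ψ : Fock (Orb (FermionTorus 2 L))}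
    (hE : hubbardTorusTT' L 1 tp U *ᵥ ψ = ((E : ℝ) : ℂ) • ψ) :
    (star ((hubbardTorusTT' L 1 tp U * curOpTT' L tp - curOpTT' L tp * hubbardTorusTT' L 1 tp U) *ᵥ ψ) ⬝ᵥ
          (hubbardTorusTT' L 1 tp U *ᵥ
            ((hubbardTorusTT' L 1 tp U * curOpTT' L tp - curOpTT' L tp * hubbardTorusTT' L 1 tp U) *ᵥ ψ))).re -
        E * (star ((hubbardTorusTT' L 1 tp U * curOpTT' L tp - curOpTT' L tp * hubbardTorusTT' L 1 tp U) *ᵥ ψ) ⬝ᵥ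
          ((hubbardTorusTT' L 1 tp U * curOpTT' L tp - curOpTT' L tp * hubbardTorusTT' L 1 tp U) *ᵥ ψ)).re =
      -((L : ℝ) ^ 2 / 2) * (torusAvgExpectAt L (box 2 7) (thirdMomentObsTT tp U) ψ).re := by
  have hΩ : Set.InjOn (Torus.proj (d := 2) L) ↑(box 2 7) := injOn_proj_box (by omega)
  have hZ5 : Set.InjOn (Torus.proj (d := 2) L) ↑(box 2 5) := injOn_proj_box (by omega)
  have h27 : box 2 2 ⊆ box 2 7 := box_subset_box (by norm_num)
  have h37 : box 2 3 ⊆ box 2 7 := box_subset_box (by norm_num)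
  have hBa := conjTranspose_commutator_curOpTT'_TT L tp U
  -- (1) `m₃ = Re⟨Bψ, Cψ⟩ = -Re⟨ψ, B C ψ⟩`, `C = HB − BH`
  have hstep1 :
      (star ((hubbardTorusTT' L 1 tp U * curOpTT' L tp - curOpTT' L tp * hubbardTorusTT' L 1 tp U) *ᵥ ψ) ⬝ᵥ
          (hubbardTorusTT' L 1 tp U *ᵥ
            ((hubbardTorusTT' L 1 tp U * curOpTT' L tp - curOpTT' L tp * hubbardTorusTT' L 1 tp U) *ᵥ ψ))).re -
        E * (star ((hubbardTorusTT' L 1 tp U * curOpTT' L tp - curOpTT' L tp * hubbardTorusTT' L 1 tp U) *ᵥ ψ) ⬝ᵥ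
          ((hubbardTorusTT' L 1 tp U * curOpTT' L tp - curOpTT' L tp * hubbardTorusTT' L 1 tp U) *ᵥ ψ)).re =
      -(star ψ ⬝ᵥ (((hubbardTorusTT' L 1 tp U * curOpTT' L tp - curOpTT' L tp * hubbardTorusTT' L 1 tp U) *
        (hubbardTorusTT' L 1 tp U *
            (hubbardTorusTT' L 1 tp U * curOpTT' L tp - curOpTT' L tp * hubbardTorusTT' L 1 tp U) -
          (hubbardTorusTT' L 1 tp U * curOpTT' L tp - curOpTT' L tp * hubbardTorusTT' L 1 tp U) *
            hubbardTorusTT' L 1 tp U)) *ᵥ ψ)).re := by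
    have hC : (hubbardTorusTT' L 1 tp U *
            (hubbardTorusTT' L 1 tp U * curOpTT' L tp - curOpTT' L tp * hubbardTorusTT' L 1 tp U) -
          (hubbardTorusTT' L 1 tp U * curOpTT' L tp - curOpTT' L tp * hubbardTorusTT' L 1 tp U) *
            hubbardTorusTT' L 1 tp U) *ᵥ ψ =
        hubbardTorusTT' L 1 tp U *ᵥ
            ((hubbardTorusTT' L 1 tp U * curOpTT' L tp - curOpTT' L tp * hubbardTorusTT' L 1 tp U) *ᵥ ψ) -
          ((E : ℝ) : ℂ) •
            ((hubbardTorusTT' L 1 tp U * curOpTT' L tp - curOpTT' L tp * hubbardTorusTT' L 1 tp U) *ᵥ ψ) := by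
      rw [sub_mulVec, ← mulVec_mulVec, ← mulVec_mulVec, hE, mulVec_smul]
    have hadj : ∀ w : Fock (Orb (FermionTorus 2 L)),
        star ψ ⬝ᵥ ((hubbardTorusTT' L 1 tp U * curOpTT' L tp - curOpTT' L tp * hubbardTorusTT' L 1 tp U) *ᵥ w) =
          -(star ((hubbardTorusTT' L 1 tp U * curOpTT' L tp - curOpTT' L tp * hubbardTorusTT' L 1 tp U) *ᵥ ψ) ⬝ᵥ w) := by
      intro w
      rw [star_mulVec, ← dotProduct_mulVec, hBa, Matrix.neg_mulVec, dotProduct_neg, neg_neg]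
    rw [← mulVec_mulVec, hC, mulVec_sub, mulVec_smul, dotProduct_sub, dotProduct_smul, smul_eq_mul, hadj, hadj]
    simp only [Complex.neg_re, Complex.sub_re, Complex.mul_re, Complex.ofReal_re, Complex.ofReal_im, zero_mul,
      sub_zero]
    ring
  -- (2) `Re⟨ψ, BCψ⟩ = ½Re⟨ψ, [B,C]ψ⟩` (`B` anti-Hermitian, `C` Hermitian)
  have hCh : (hubbardTorusTT' L 1 tp U *
          (hubbardTorusTT' L 1 tp U * curOpTT' L tp - curOpTT' L tp * hubbardTorusTT' L 1 tp U) -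
        (hubbardTorusTT' L 1 tp U * curOpTT' L tp - curOpTT' L tp * hubbardTorusTT' L 1 tp U) *
          hubbardTorusTT' L 1 tp U)ᴴ =
      hubbardTorusTT' L 1 tp U *
          (hubbardTorusTT' L 1 tp U * curOpTT' L tp - curOpTT' L tp * hubbardTorusTT' L 1 tp U) -
        (hubbardTorusTT' L 1 tp U * curOpTT' L tp - curOpTT' L tp * hubbardTorusTT' L 1 tp U) *
          hubbardTorusTT' L 1 tp U := by
    have hH : (hubbardTorusTT' L 1 tp U)ᴴ = hubbardTorusTT' L 1 tp U := (hubbardTorusTT'_isHermitian L 1 tp U).eq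
    rw [conjTranspose_sub, conjTranspose_mul, conjTranspose_mul, hBa, hH, neg_mul, mul_neg, neg_sub_neg]
  have hXY : ((hubbardTorusTT' L 1 tp U * curOpTT' L tp - curOpTT' L tp * hubbardTorusTT' L 1 tp U) *
        (hubbardTorusTT' L 1 tp U *
            (hubbardTorusTT' L 1 tp U * curOpTT' L tp - curOpTT' L tp * hubbardTorusTT' L 1 tp U) -
          (hubbardTorusTT' L 1 tp U * curOpTT' L tp - curOpTT' L tp * hubbardTorusTT' L 1 tp U) *
            hubbardTorusTT' L 1 tp U))ᴴ =
      -((hubbardTorusTT' L 1 tp U *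
            (hubbardTorusTT' L 1 tp U * curOpTT' L tp - curOpTT' L tp * hubbardTorusTT' L 1 tp U) -
          (hubbardTorusTT' L 1 tp U * curOpTT' L tp - curOpTT' L tp * hubbardTorusTT' L 1 tp U) *
            hubbardTorusTT' L 1 tp U) *
        (hubbardTorusTT' L 1 tp U * curOpTT' L tp - curOpTT' L tp * hubbardTorusTT' L 1 tp U)) := by
    rw [conjTranspose_mul, hCh, hBa, mul_neg]
  rw [hstep1, re_star_dotProduct_mul_mulVec_eq_half _ _ hXY]
  -- (3) `[B, C]` is the translation sum of `Γ(m₃')`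
  have hcomm : star ψ ⬝ᵥ (((hubbardTorusTT' L 1 tp U * curOpTT' L tp - curOpTT' L tp * hubbardTorusTT' L 1 tp U) *
        (hubbardTorusTT' L 1 tp U *
            (hubbardTorusTT' L 1 tp U * curOpTT' L tp - curOpTT' L tp * hubbardTorusTT' L 1 tp U) -
          (hubbardTorusTT' L 1 tp U * curOpTT' L tp - curOpTT' L tp * hubbardTorusTT' L 1 tp U) *
            hubbardTorusTT' L 1 tp U) -
      (hubbardTorusTT' L 1 tp U *
            (hubbardTorusTT' L 1 tp U * curOpTT' L tp - curOpTT' L tp * hubbardTorusTT' L 1 tp U) -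
          (hubbardTorusTT' L 1 tp U * curOpTT' L tp - curOpTT' L tp * hubbardTorusTT' L 1 tp U) *
            hubbardTorusTT' L 1 tp U) *
        (hubbardTorusTT' L 1 tp U * curOpTT' L tp - curOpTT' L tp * hubbardTorusTT' L 1 tp U)) *ᵥ ψ) =
      ((L : ℂ) ^ 2) * torusAvgExpectAt L (box 2 7) (thirdMomentObsTT tp U) ψ := by
    have h := expect_commutator_sum_relabel_translate L hΩ hZ5 h27 h37
      (fun z hz => by simpa using shiftSet_subset_box_add (subset_refl (box 2 2)) hz)
      (fun a ha c hc => by simpa using sub_mem_box_add ha hc) (curDerivObsTT_mem_carEvenSubalgebra tp U)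
      (curDeriv2ObsTT tp U) ψ
    rw [← hubbardTorusTT'_commutator_curOpTT' L tp U (by omega),
      ← hubbardTorusTT'_commutator_commutator_curOpTT' L tp U (by omega)] at h
    exact h
  rw [hcomm, show ((L : ℂ) ^ 2 * torusAvgExpectAt L (box 2 7) (thirdMomentObsTT tp U) ψ).re =
      (L : ℝ) ^ 2 * (torusAvgExpectAt L (box 2 7) (thirdMomentObsTT tp U) ψ).re by
    rw [← Complex.ofReal_natCast, ← Complex.ofReal_pow, Complex.re_ofReal_mul]]
  ring

/-- **The per-side odd-moment functional of a sector ground state of the `t–t'` torus is a combination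
of torus averages of LOCAL observables** (`L ≥ 15`). [cite: Lipparini2008, eq. (8.30)] -/
theorem oddMomentFunctionalTT'_eq_torusAvgExpect (tp U δ lam : ℝ) (hL : 15 ≤ L)
    {ψ : Fock (Orb (FermionTorus 2 L))}
    (hgs : IsGroundStateInSector (hubbardTorusTT' L 1 tp U) (2 * ⌊(1 - δ) * (L : ℝ) ^ 2 / 2⌋₊) 0 ψ) :
    oddMomentFunctionalTT' tp U δ lam L ψ =
      (torusAvgExpect L (box 2 1) (kinBondObsTT tp) ψ).re / 2 +
        lam * (torusAvgExpect L (box 2 4) (firstMomentObsTT tp U) ψ).re -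
        lam ^ 2 / 2 * (torusAvgExpect L (box 2 7) (thirdMomentObsTT tp U) ψ).re := by
  have hE : hubbardTorusTT' L 1 tp U *ᵥ ψ = ((fluxEnergyTT' L tp U δ 0 : ℝ) : ℂ) • ψ := by
    rw [fluxEnergyTT'_eq, hubbardTorusTT'Flux_zero]
    exact hgs.2.2
  have h1 : Set.InjOn (Torus.proj (d := 2) L) ↑(box 2 1) := injOn_proj_box (by omega)
  have hkin : (star ψ ⬝ᵥ (kinOpTT' L tp *ᵥ ψ)).re =
      (L : ℝ) ^ 2 * (torusAvgExpectAt L (box 2 1) (kinBondObsTT tp) ψ).re := by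
    rw [kinOpTT'_eq_sum_translate L tp h1,
      show star ψ ⬝ᵥ ((∑ v : TorusSite 2 L, relabel (Orb.translate v)
        (fermionEmbed (PolySite.toTorusEmb L h1) (kinBondObsTT tp))) *ᵥ ψ) =
        Literature.MathematicalPhysics.QuantumLattice.expect (∑ v : TorusSite 2 L, relabel (Orb.translate v)
          (fermionEmbed (PolySite.toTorusEmb L h1) (kinBondObsTT tp))) ψ from rfl,
      expect_sum_relabel_translate_fermionEmbed' L h1, ← Complex.ofReal_natCast, ← Complex.ofReal_pow,
      Complex.re_ofReal_mul]
  have hLpos : (0 : ℝ) < (L : ℝ) ^ 2 := by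
    have : (0 : ℝ) < (L : ℝ) := Nat.cast_pos.2 (NeZero.pos L)
    positivity
  rw [oddMomentFunctionalTT'_eq, hkin, firstMoment_eq_torusAvgExpectTT L tp U (by omega) hE,
    thirdMoment_eq_torusAvgExpectTT L tp U hL hE, torusAvgExpect_eq, torusAvgExpect_eq, torusAvgExpect_eq]
  field_simp
  ring

end Finite

/-! ### The generic row adapter for the `t–t'` class -/

/-- **Generic row adapter, `t–t'` torus.** Let `−1 ≤ δ ≤ 1` and let `Φ L ψ ∈ ℝ` be a per-side functional of
unit sector ground states with (i) `ρ_s ≤ Φ L ψ` for every unit `(rectN (1−δ) L, 0)`-sector ground state `ψ`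
of `hubbardTorusTT' L 1 t' U` at every even side `L ≥ L₀`, `L ≥ 3`; (ii) along every torus-limit sequence of
such ground states (sides `Ls j → ∞`), `Φ (Ls j) (ψ (Ls j)) → Φ∞ ω`; (iii) `Φ∞ ω ≤ q` for every torus limit
`ω` (the certificate). Then `ρ_s ≤ q` (unit sector ground states exist,
`exists_unit_isGroundStateInSector_hubbardTorusTT'`; weak-⋆ compactness along the even sides).
[cite: BratteliRobinsonI1987, §4.3.1] -/
theorem fluxStiffness_le_of_torusLimitTT'_functional_row (tp : ℝ) {U δ ρs q : ℝ} (hδ : -1 ≤ δ)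
    (hδ1 : δ ≤ 1) {L₀ : ℕ}
    (Φ : ∀ L : ℕ, Fock (Orb (FermionTorus 2 L)) → ℝ) (Φinf : InfVolFermionState 2 → ℝ)
    (hfin : ∀ (L : ℕ) [NeZero L], L₀ ≤ L → 3 ≤ L → Even L →
      ∀ ψ : Fock (Orb (FermionTorus 2 L)),
        IsGroundStateInSector (hubbardTorusTT' L 1 tp U) (rectN (1 - δ) L) 0 ψ → star ψ ⬝ᵥ ψ = 1 →
          ρs ≤ Φ L ψ)
    (hconv : ∀ (ω : InfVolFermionState 2) (Ls : ℕ → ℕ) (ψ : ∀ L, Fock (Orb (FermionTorus 2 L))),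
      Tendsto Ls atTop atTop →
      (∀ j, IsGroundStateInSector (hubbardTorusTT' (Ls j) 1 tp U) (rectN (1 - δ) (Ls j)) 0 (ψ (Ls j))) →
      (∀ j, star (ψ (Ls j)) ⬝ᵥ ψ (Ls j) = 1) → ω.IsTorusLimitOf ψ Ls →
        Tendsto (fun j => Φ (Ls j) (ψ (Ls j))) atTop (𝓝 (Φinf ω)))
    (hrow : ∀ (ω : InfVolFermionState 2) (Ls : ℕ → ℕ) (ψ : ∀ L, Fock (Orb (FermionTorus 2 L))),
      Tendsto Ls atTop atTop →
      (∀ j, IsGroundStateInSector (hubbardTorusTT' (Ls j) 1 tp U) (rectN (1 - δ) (Ls j)) 0 (ψ (Ls j))) →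
      (∀ j, star (ψ (Ls j)) ⬝ᵥ ψ (Ls j) = 1) → ω.IsTorusLimitOf ψ Ls → Φinf ω ≤ q) :
    ρs ≤ q := by
  have hn0 : 0 ≤ 1 - δ := by linarith
  have hn2 : 1 - δ ≤ 2 := by linarith
  -- a unit sector ground state at every side
  let ψ : ∀ L, Fock (Orb (FermionTorus 2 L)) := fun L =>
    Classical.choose (exists_unit_isGroundStateInSector_hubbardTorusTT' L 1 tp U hn0 hn2)
  have hψgs : ∀ L, IsGroundStateInSector (hubbardTorusTT' L 1 tp U) (rectN (1 - δ) L) 0 (ψ L) := fun L =>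
    (Classical.choose_spec (exists_unit_isGroundStateInSector_hubbardTorusTT' L 1 tp U hn0 hn2)).1
  have hψ1 : ∀ L, star (ψ L) ⬝ᵥ ψ L = 1 := fun L =>
    (Classical.choose_spec (exists_unit_isGroundStateInSector_hubbardTorusTT' L 1 tp U hn0 hn2)).2
  -- the even sides `2(j+1) → ∞`
  let Ls : ℕ → ℕ := fun j => 2 * (j + 1)
  have hLs : Tendsto Ls atTop atTop :=
    tendsto_atTop_mono (fun j : ℕ => (by omega : j ≤ 2 * (j + 1))) tendsto_id
  obtain ⟨φ, hφ, ω, hω⟩ :=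
    InfVolFermionState.exists_isTorusLimitOf_subseq ψ hLs (fun j => hψ1 (Ls j))
  have hLs' : Tendsto (Ls ∘ φ) atTop atTop := hLs.comp hφ.tendsto_atTop
  have hev : ∀ᶠ j in atTop, ρs ≤ Φ ((Ls ∘ φ) j) (ψ ((Ls ∘ φ) j)) := by
    filter_upwards [hLs'.eventually_ge_atTop (max L₀ 3)] with j hj
    have hL3 : 3 ≤ (Ls ∘ φ) j := le_trans (le_max_right _ _) hj
    have hL0 : L₀ ≤ (Ls ∘ φ) j := le_trans (le_max_left _ _) hj
    haveI : NeZero ((Ls ∘ φ) j) := ⟨by omega⟩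
    exact hfin ((Ls ∘ φ) j) hL0 hL3 (even_two_mul _) (ψ _) (hψgs _) (hψ1 _)
  have hlim := hconv ω (Ls ∘ φ) ψ hLs' (fun j => hψgs _) (fun j => hψ1 _) hω
  have hle : ρs ≤ Φinf ω := ge_of_tendsto hlim hev
  exact hle.trans (hrow ω (Ls ∘ φ) ψ hLs' (fun j => hψgs _) (fun j => hψ1 _) hω)

/-! ### Identification and the unconditional adapter -/

/-- **IDENTIFICATION, `t–t'` torus.** Along every torus-limit sequence of `(rectN (1−δ) L, 0)`-sector
ground states of `hubbardTorusTT' (Ls j) 1 t' U` with torus limit `ω`, the per-side fixed-`λ` odd-moment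
functional converges to `oddMomentLimitFunctionalTT t' U λ ω`. [cite: BratteliRobinsonI1987, §4.3.1] -/
theorem tendsto_oddMomentFunctionalTT'_of_isTorusLimitOf (tp U δ lam : ℝ)
    (ω : InfVolFermionState 2) (Ls : ℕ → ℕ) (ψ : ∀ L, Fock (Orb (FermionTorus 2 L)))
    (hLs : Tendsto Ls atTop atTop)
    (hgs : ∀ j, IsGroundStateInSector (hubbardTorusTT' (Ls j) 1 tp U) (rectN (1 - δ) (Ls j)) 0 (ψ (Ls j)))
    (hω : ω.IsTorusLimitOf ψ Ls) :
    Tendsto (fun j => oddMomentFunctionalTT' tp U δ lam (Ls j) (ψ (Ls j))) atTop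
      (𝓝 (oddMomentLimitFunctionalTT tp U lam ω)) := by
  have hlim : Tendsto (fun j => (torusAvgExpect (Ls j) (box 2 1) (kinBondObsTT tp) (ψ (Ls j))).re / 2 +
        lam * (torusAvgExpect (Ls j) (box 2 4) (firstMomentObsTT tp U) (ψ (Ls j))).re -
        lam ^ 2 / 2 * (torusAvgExpect (Ls j) (box 2 7) (thirdMomentObsTT tp U) (ψ (Ls j))).re) atTop
      (𝓝 (oddMomentLimitFunctionalTT tp U lam ω)) := by
    unfold oddMomentLimitFunctionalTT
    exact ((((Complex.continuous_re.tendsto _).comp (hω _ (kinBondObsTT tp))).div_const 2).add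
      (((Complex.continuous_re.tendsto _).comp (hω _ (firstMomentObsTT tp U))).const_mul lam)).sub
      (((Complex.continuous_re.tendsto _).comp (hω _ (thirdMomentObsTT tp U))).const_mul (lam ^ 2 / 2))
  refine hlim.congr' ?_
  filter_upwards [hLs.eventually_ge_atTop 15] with j hj
  haveI : NeZero (Ls j) := ⟨by omega⟩
  exact (oddMomentFunctionalTT'_eq_torusAvgExpect (Ls j) tp U δ lam hj (hgs j)).symm

/-- **The `R-K3-TL` row adapter for the `t–t'` torus, UNCONDITIONAL.** Let `−1 ≤ δ ≤ 1`, `λ ∈ ℝ`, and let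
`ρ_s, θ₀ > 0` be a uniform flux stiffness of the zero-flux `(N_L, S^z = 0)` sectors of `hubbardTorusTT' L 1 t' U`
along all even `L ≥ L₀` (`ρ_s θ² ≤ E_L(θ) − E_L(0)`, `E_L = fluxEnergyTT' L t' U δ`). If a certificate gives
`oddMomentLimitFunctionalTT t' U λ ω ≤ q` for EVERY torus limit `ω` of unit sector ground states along sides
`Ls → ∞`, then `ρ_s ≤ q` (tree units; `D_s^{HVR} = ρ_s/2`, `D^{SWZ}/(πe²) = 2ρ_s`).
[cite: Lipparini2008, eq. (8.30)] [cite: ScalapinoWhiteZhang1993, §II] -/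
theorem fluxStiffness_le_of_torusLimitTT'_oddMoment_certificate (tp : ℝ) {U δ ρs θ₀ q : ℝ} (lam : ℝ)
    (hδ : -1 ≤ δ) (hδ1 : δ ≤ 1) (hθ₀ : 0 < θ₀) {L₀ : ℕ}
    (hst : ∀ (L : ℕ) [NeZero L], L₀ ≤ L → Even L →
      ∀ θ : ℝ, |θ| ≤ θ₀ → ρs * θ ^ 2 ≤ fluxEnergyTT' L tp U δ θ - fluxEnergyTT' L tp U δ 0)
    (hrow : ∀ (ω : InfVolFermionState 2) (Ls : ℕ → ℕ) (ψ : ∀ L, Fock (Orb (FermionTorus 2 L))),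
      Tendsto Ls atTop atTop →
      (∀ j, IsGroundStateInSector (hubbardTorusTT' (Ls j) 1 tp U) (rectN (1 - δ) (Ls j)) 0 (ψ (Ls j))) →
      (∀ j, star (ψ (Ls j)) ⬝ᵥ ψ (Ls j) = 1) → ω.IsTorusLimitOf ψ Ls →
        oddMomentLimitFunctionalTT tp U lam ω ≤ q) :
    ρs ≤ q := by
  refine fluxStiffness_le_of_torusLimitTT'_functional_row tp hδ hδ1 (L₀ := L₀) (oddMomentFunctionalTT' tp U δ lam)
    (oddMomentLimitFunctionalTT tp U lam) ?_
    (fun ω Ls ψ hLs hgs _ hω => tendsto_oddMomentFunctionalTT'_of_isTorusLimitOf tp U δ lam ω Ls ψ hLs hgs hω)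
    hrow
  intro L _ hL0 hL3 hEven ψ hgs h1
  have hfin := fluxStiffness_mul_sq_le_kinetic_add_oddMomentsTT L hL3 tp hθ₀ (hst L hL0 hEven) hgs h1 lam
  have hLpos : (0 : ℝ) < (L : ℝ) ^ 2 := by
    have : (0 : ℝ) < (L : ℝ) := Nat.cast_pos.2 (NeZero.pos L)
    positivity
  rw [oddMomentFunctionalTT'_eq, le_div_iff₀ hLpos]
  exact hfin

end Summit.Ventures.CertifiedManyBodySolver.Observables

end
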